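import Summits.CriticalPhenomena.PercolationContinuityZ3.Theorems.PercNearOneGluingNoHeavyConstsChainRuleEdgeBernstein
import Summits.CriticalPhenomena.PercolationContinuityZ3.Theorems.PercNearOneGluingNoHeavyConstsRR2EdgeBernstein
import Summits.CriticalPhenomena.PercolationContinuityZ3.Theorems.PercNearOneGluingNoHeavyConstsUnconditionalChainRule
import HarnessLib
import HarnessLib.Audit.Tags

/-!
# CONJECTURE "dominated chain rule": the chain-rule minor with a dominated middle column, its proved endpoint,
# and what it signs in the edge-Bernstein expansion (PAPER-2 track (ii), constants of the CSH family)

builds on p205010 (kernel theorem, internal audit signed; external expert review pending).  Support file (`--supports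
stmt-CriticalPhenomena-4575`), seat `prim-consts-2` (gen 6); rows A6/A11 of `run/shared/lean/prim/consts/CONSTANTS.md`; memo
`run/shared/lean/prim/consts/FROM-prim-consts-2-g6-DOMINATED-CHAIN-RULE.md`.  One `Prop` definition (OPEN, `@[conjecture]`) and
theorems; no sorries; standard axioms.  Notation: `K(S,T) = μ{S ↮ T}` (the disconnection kernel of a finite weighted graph,
`μ = prodBernoulli w`); the chain-rule minor of `Consts.SingleEdgeChainRule` is `det [K(S_i,T_j)]` with rows `S = (X, X∪u, X∪uv)`
and columns `T = (Y∪v, Y, Y∪o)` (`Consts.singleEdgeChainRule_iff_det_nonneg`).  Here every COLUMN `j` gets its own base pair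
`(c_j, Y_j)` — source base `c_j`, target base `Y_j` — and the column reads `(K(c_j,T_j), K(c_j∪u,T_j), K(c_j∪uv,T_j))` with
`T₁ = Y₁∪v`, `T₂ = Y₂`, `T₃ = Y₃∪o`.  A pair `(c,Y)` DOMINATES `(c',Y')` if `c ⊇ c'` and `Y ⊆ Y'` (its conditional avoidance
ratios `K(c∪S,Y)/K(c,Y)` are the larger ones, by log-supermodularity in the source and reverse regularity in the target).
* `Consts.DominatedChainRule` — **CONJECTURE (OPEN)**: for `A ⊆ B` and `Y' ⊆ Y` the minor with columns
  `(A, Y∪v), (B, Y'), (A, Y∪o)` is `≥ 0` — the chain-rule minor stays nonnegative when its middle column is replaced by the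
  avoidance profile `(K(B,Y'), K(Bu,Y'), K(Buv,Y'))` of ANY dominating pair.  `(B,Y') = (A,Y)` is `Consts.SingleEdgeChainRule`
  (`Consts.singleEdgeChainRule_of_dominated`); `Y' = ∅` (middle column `≡ 1`) is the THEOREM `Consts.unconditionalChainRule`
  (`Consts.dominatedChainRule_emptyTarget`), so the conjecture interpolates between a proved statement and the open one.
  Expanding along the first column, `det = K(Au,Yv)·Γ₀ − K(A,Yv)·Γ_u` with `Γ₀ = K(A,Yo)K(Buv,Y') − K(B,Y')K(Auv,Yo) ≥ 0`;
  in conditional form (`α = P(u↮Yv | A↮Yv)`, `βᵢ = P(u↮Y' | B↮Y'), P(uv↮Y' | B↮Y')`, `γᵢ = P(u↮Yo | A↮Yo), P(uv↮Yo | A↮Yo)`)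
  it reads `(γ₁ − α)·β₂ ≤ (β₁ − α)·γ₂` and is automatic when `γ₁ ≤ α`.  EVIDENCE (exact rational arithmetic, kit census
  j136853 = all 728 connected graphs on 5 vertices × palettes {1/2}, {1/3,2/3} alternating, all placements; j136854/j136855 = 950
  random weighted graphs `n ≤ 8`): 0 violations in 1 720 420 instances of the conjecture (302 422 + 22 875 equalities), 0 in
  1 720 420 of the three-column form, 0 in 1 591 290 of the case `Y' = Y`; the reversed domination (`B ⊊ A` or `Y' ⊋ Y`) fails in
  289 492 of 1 720 420; equality e.g. whenever `u` is pendant to `v`.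
* `Consts.threeColumn_nonneg_of_dominated` — **THEOREM: the conjecture implies the three-column form**: the minor with columns
  `(c₁, Y∪v), (c₂, Y₂), (c₃, Y∪o)` is `≥ 0` whenever `c₁ ⊇ c₃`, `c₂ ⊇ c₃`, `Y₂ ⊆ Y` (log-supermodularity in the source,
  `Consts.real_avoid_insert_mul_le`, and reverse regularity `Consts.disconnect_rr2`: the ratio `K(c₁u,Yv)/K(c₁,Yv)` is monotone in
  `c₁`, so the binding case is `c₁ = c₃`).
* `Consts.colMixed_nonneg_of_dominated` — **THEOREM: under the conjecture three of the six mixed Bernstein determinants of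
  `Consts.ChainRuleEdgeBernstein` are nonnegative.**  Along a source edge `xz` the coefficients `β₁, β₂` of the chain-rule cubic
  are the COLUMN sums `β₁ = D(Xz,X,X) + D(X,Xz,X) + D(X,X,Xz)`, `β₂ = D(Xz,Xz,X) + D(Xz,X,Xz) + D(X,Xz,Xz)`
  (`Consts.edgeBernstein_rowMix_eq_colMix`, `D(c₁,c₂,c₃)` = the minor with source bases `c_j` and all `Y_j = Y`); the conjecture
  signs `D(Xz,X,X), D(X,Xz,X), D(Xz,Xz,X) ≥ 0` (the `Yo`-column has the smallest source), so EB reduces to bounds on the terms in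
  which `z` enters the `Yo`-column's source: `D(X,X,Xz) ≥ −(D(Xz,X,X) + D(X,Xz,X))` and `D(Xz,X,Xz) + D(X,Xz,Xz) ≥ −D(Xz,Xz,X)`
  (exact census j136853–5: `β₁, β₂ ≥ 0` in 482 373/482 373 edge instances while the single terms `D(X,X,Xz)`, `D(Xz,X,Xz)`,
  `D(X,Xz,Xz)` are negative in 159 010, 98 036, 105 282 of them).
[cite: VandenbergHaggstromKahn2005, Thm. 1.1 (pp. 3–5), Thm. 1.5 (p. 7)]
-/

noncomputable section

namespace Summit.CriticalPhenomena.PercolationContinuityZ3.Theorems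

open MeasureTheory Set Literature.Probability.LatticeModels Literature.Probability.Percolation
open scoped Classical

namespace Consts

/-- Notation (this file only): the disconnection kernel `𝕂[w](S, T) = μ_w{S ↮ T}`. -/
local notation3 "𝕂[" w "](" S ", " T ")" =>
  MeasureTheory.Measure.real (prodBernoulli w) {ω | ∀ s ∈ S, ∀ t ∈ T, ¬ (openGraph ω).Reachable s t}

/-- Notation (this file only): the chain-rule minor with column bases `(c₁,Y₁), (c₂,Y₂), (c₃,Y₃)`: column `j` is
`(K(c_j,T_j), K(c_j∪u,T_j), K(c_j∪u∪v,T_j))` with targets `T₁ = Y₁∪v`, `T₂ = Y₂`, `T₃ = Y₃∪o`. -/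
local notation3 "𝔻ᶜ[" w "](" c₁ ", " Y₁ " ; " c₂ ", " Y₂ " ; " c₃ ", " Y₃ " | " u ", " v ", " o ")" =>
  Matrix.det !![𝕂[w](c₁, insert v Y₁), 𝕂[w](c₂, Y₂), 𝕂[w](c₃, insert o Y₃);
                 𝕂[w](insert u c₁, insert v Y₁), 𝕂[w](insert u c₂, Y₂), 𝕂[w](insert u c₃, insert o Y₃);
                 𝕂[w](insert v (insert u c₁), insert v Y₁), 𝕂[w](insert v (insert u c₂), Y₂),
                   𝕂[w](insert v (insert u c₃), insert o Y₃)]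

/-- **CONJECTURE "dominated chain rule" (OPEN).**  For every finite weighted graph (`Fin n`, weights `w`), source sets `A ⊆ B`,
vertices `u, v, o` and target sets `Y' ⊆ Y`: the chain-rule minor whose outer columns are those of `Consts.SingleEdgeChainRule` for
the source set `A` (targets `Y∪v`, `Y∪o`) and whose middle column is the avoidance profile `(K(B,Y'), K(B∪u,Y'), K(B∪uv,Y'))`
of the dominating pair `(B,Y')` is nonnegative.  `(B,Y') = (A,Y)`: the single-edge chain rule (open); `Y' = ∅`: the unconditional
chain rule (proved, `Consts.dominatedChainRule_emptyTarget`).  Exact census (seat prim-consts-2 gen 6, kit j136853–5): 0 violations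
in 1 720 420 instances `n ≤ 8`; the reversed domination fails. [cite: VandenbergHaggstromKahn2005, Thm. 1.1 (pp. 3–5)] [status: open] -/
@[conjecture] def DominatedChainRule : Prop :=
  ∀ (n : ℕ) (w : Sym2 (Fin n) → unitInterval) (A B : Set (Fin n)) (u v o : Fin n) (Y Y' : Set (Fin n)),
    A ⊆ B → Y' ⊆ Y → 0 ≤ 𝔻ᶜ[w](A, Y ; B, Y' ; A, Y | u, v, o)

variable {V : Type*} [Fintype V]

/-! ### Kernel facts used below -/

omit [Fintype V] in
/-- Antitonicity of the disconnection kernel in both arguments. [folklore] -/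
theorem real_avoid_anti (w : Sym2 V → unitInterval) {S S' T T' : Set V} (hS : S ⊆ S') (hT : T ⊆ T') :
    𝕂[w](S', T') ≤ 𝕂[w](S, T) :=
  measureReal_mono (fun _ hω s hs t ht => hω s (hS hs) t (hT ht)) (measure_ne_top _ _)

omit [Fintype V] in
/-- `K(S, ∅) = 1`. [folklore] -/
theorem real_avoid_emptyTarget (w : Sym2 V → unitInterval) (S : Set V) : 𝕂[w](S, (∅ : Set V)) = 1 := by
  have hset : {ω : BondConfig V | ∀ s ∈ S, ∀ t ∈ (∅ : Set V), ¬ (openGraph ω).Reachable s t} = univ := by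
    ext ω; simp
  rw [hset]; simp

/-- **Monotone avoidance ratio (log-supermodularity in the source, iterated).**  For `S ⊆ S'` (finite) and any `u`, `T`:
`K(S'∪u,T)·K(S,T) ≥ K(S',T)·K(S∪u,T)`, i.e. `P(u ↮ T | S ↮ T)` is monotone in the source set `S`; one vertex at a time from
`Consts.real_avoid_insert_mul_le`. [cite: VandenbergHaggstromKahn2005, Thm. 1.1 (pp. 3–5)] -/
theorem real_avoid_insert_ratio_mono (w : Sym2 V → unitInterval) (S T : Set V) (u : V) (D : Finset V) :
    𝕂[w](S ∪ ↑D, T) * 𝕂[w](insert u S, T) ≤ 𝕂[w](S, T) * 𝕂[w](insert u (S ∪ ↑D), T) := by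
  classical
  induction D using Finset.induction_on with
  | empty => simp
  | @insert b D hb ih =>
    set S' : Set V := S ∪ ↑D with hS'
    have hins : S ∪ ↑(insert b D) = insert b S' := by
      rw [Finset.coe_insert, hS', Set.union_insert]
    rw [hins]
    -- log-supermodularity at `S'` with the two vertices `u, b`
    have hLS := real_avoid_insert_mul_le w S' T u b
    have hcomm : insert b (insert u S') = insert u (insert b S') := insert_comm b u S'
    rw [hcomm] at hLS
    have h0 : 0 ≤ 𝕂[w](S, T) := measureReal_nonneg
    have h1 : 0 ≤ 𝕂[w](insert b S', T) := measureReal_nonneg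
    have h2 : 0 ≤ 𝕂[w](insert u S, T) := measureReal_nonneg
    have h3 : 0 ≤ 𝕂[w](insert u (insert b S'), T) := measureReal_nonneg
    by_cases hz : 𝕂[w](S', T) = 0
    · -- then `K(insert b S', T) = 0` as well
      have hle : 𝕂[w](insert b S', T) ≤ 𝕂[w](S', T) := real_avoid_anti w (subset_insert _ _) subset_rfl
      have hbz : 𝕂[w](insert b S', T) = 0 := le_antisymm (hz ▸ hle) h1
      rw [hbz, zero_mul]; exact mul_nonneg h0 h3
    · have hpos : 0 < 𝕂[w](S', T) := lt_of_le_of_ne measureReal_nonneg (Ne.symm hz)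
      -- `K(S')·[K(S) K(u b S') − K(b S') K(u S)] ≥ 0`
      have key : 𝕂[w](S', T) * (𝕂[w](insert b S', T) * 𝕂[w](insert u S, T)) ≤
          𝕂[w](S', T) * (𝕂[w](S, T) * 𝕂[w](insert u (insert b S'), T)) := by
        linarith [mul_le_mul_of_nonneg_right hLS h0, mul_le_mul_of_nonneg_right ih h1]
      exact le_of_mul_le_mul_left key hpos

omit [Fintype V] in
/-- The `3 × 3` determinant with a vanishing `(3,1)` entry, expanded along the first column. [folklore] -/
theorem det3_col1 (a b c d e f h i : ℝ) :
    Matrix.det !![a, b, c; d, e, f; 0, h, i] = d * (c * h - b * i) - a * (f * h - e * i) := by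
  rw [det3_eq]; ring

/-! ### The conjecture implies the single-edge chain rule and the three-column form -/

/-- **THEOREM: `DominatedChainRule → SingleEdgeChainRule`** (the case `B = A = {x}`, `Y' = Y`).
[cite: VandenbergHaggstromKahn2005, Thm. 1.1 (pp. 3–5)] -/
theorem singleEdgeChainRule_of_dominated (h : DominatedChainRule) : SingleEdgeChainRule := by
  rw [singleEdgeChainRule_iff_det_nonneg]
  intro n w x u v o Y
  have h0 := h n w {x} {x} u v o Y Y subset_rfl subset_rfl
  have e2 : insert u ({x} : Set (Fin n)) = {x, u} := pair_comm u x
  have e3 : insert v ({x, u} : Set (Fin n)) = {x, u, v} := by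
    ext b; simp only [mem_insert_iff, mem_singleton_iff]; tauto
  rw [e2, e3] at h0
  exact h0

/-- **THEOREM (three-column form): under `DominatedChainRule`, the minor with column bases `(c₁,Y), (c₂,Y₂), (c₃,Y)` is
nonnegative whenever `c₃ ⊆ c₁`, `c₃ ⊆ c₂` and `Y₂ ⊆ Y`.**  Expanding along the first column,
`det = K(c₁u,Yv)·Γ₀ − K(c₁,Yv)·Γ_u` with `Γ₀ = K(c₃,Yo)K(c₂uv,Y₂) − K(c₂,Y₂)K(c₃uv,Yo) ≥ 0` (reverse regularity + source
log-supermodularity); the hypothesis at `(A,B,Y') = (c₃,c₂,Y₂)` gives `K(c₃u,Yv)·Γ₀ ≥ K(c₃,Yv)·Γ_u`, and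
`K(c₁u,Yv)K(c₃,Yv) ≥ K(c₁,Yv)K(c₃u,Yv)` (`Consts.real_avoid_insert_ratio_mono`).
[cite: VandenbergHaggstromKahn2005, Thm. 1.1 (pp. 3–5), Thm. 1.5 (p. 7)] -/
theorem threeColumn_nonneg_of_dominated (h : DominatedChainRule) (n : ℕ) (w : Sym2 (Fin n) → unitInterval)
    (c₁ c₂ c₃ : Set (Fin n)) (u v o : Fin n) (Y Y₂ : Set (Fin n)) (h₁ : c₃ ⊆ c₁) (h₂ : c₃ ⊆ c₂) (hY : Y₂ ⊆ Y) :
    0 ≤ 𝔻ᶜ[w](c₁, Y ; c₂, Y₂ ; c₃, Y | u, v, o) := by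
  classical
  -- names: column 1 (bases `c₁` and `c₃`, target `Yv`), column 2 (`c₂`, `Y₂`), column 3 (`c₃`, `Yo`)
  set N1 := 𝕂[w](c₁, insert v Y) with hN1
  set N2 := 𝕂[w](insert u c₁, insert v Y) with hN2
  set L1 := 𝕂[w](c₃, insert v Y) with hL1
  set L2 := 𝕂[w](insert u c₃, insert v Y) with hL2
  set M1 := 𝕂[w](c₂, Y₂) with hM1
  set M2 := 𝕂[w](insert u c₂, Y₂) with hM2
  set M3 := 𝕂[w](insert v (insert u c₂), Y₂) with hM3
  set P1 := 𝕂[w](c₃, insert o Y) with hP1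
  set P2 := 𝕂[w](insert u c₃, insert o Y) with hP2
  set P3 := 𝕂[w](insert v (insert u c₃), insert o Y) with hP3
  have hv : v ∈ insert v Y := mem_insert _ _
  have hN3 : 𝕂[w](insert v (insert u c₁), insert v Y) = 0 := real_avoid_eq_zero_of_mem w (mem_insert _ _) hv
  have hL3 : 𝕂[w](insert v (insert u c₃), insert v Y) = 0 := real_avoid_eq_zero_of_mem w (mem_insert _ _) hv
  rw [hN3, det3_col1]
  -- the hypothesis at `(A, B, Y') = (c₃, c₂, Y₂)`
  have hH : 0 ≤ 𝔻ᶜ[w](c₃, Y ; c₂, Y₂ ; c₃, Y | u, v, o) := h n w c₃ c₂ u v o Y Y₂ h₂ hY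
  rw [hL3, det3_col1] at hH
  -- nonnegativity of the entries
  have nN1 : 0 ≤ N1 := measureReal_nonneg
  have nN2 : 0 ≤ N2 := measureReal_nonneg
  have nL1 : 0 ≤ L1 := measureReal_nonneg
  have nM1 : 0 ≤ M1 := measureReal_nonneg
  have nP1 : 0 ≤ P1 := measureReal_nonneg
  -- (L) monotone ratio in column 1: `N2·L1 ≥ N1·L2`
  have hL : N1 * L2 ≤ L1 * N2 := by
    have hD : c₃ ∪ ↑((c₁ \ c₃).toFinite.toFinset) = c₁ := by
      ext a; simp only [mem_union, Set.Finite.coe_toFinset, mem_sdiff]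
      constructor
      · rintro (ha | ⟨ha, -⟩); exacts [h₁ ha, ha]
      · intro ha; by_cases h3 : a ∈ c₃; exacts [Or.inl h3, Or.inr ⟨ha, h3⟩]
    have := real_avoid_insert_ratio_mono w c₃ (insert v Y) u (c₁ \ c₃).toFinite.toFinset
    rw [hD] at this
    simpa only [hN1, hN2, hL1, hL2, mul_comm] using this
  -- (G) `Γ₀ = P1·M3 − M1·P3 ≥ 0`
  have hG : 0 ≤ P1 * M3 - M1 * P3 := by
    -- reverse regularity in column 3's base: `K(c₃,Y₂)·P3 ≤ P1·K(c₃uv,Y₂)`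
    have hsub : c₃ ⊆ insert v (insert u c₃) := (subset_insert _ _).trans (subset_insert _ _)
    have hrr := disconnect_rr2 w (S₁ := c₃) (S₂ := insert v (insert u c₃)) (T₁ := Y₂) (T₂ := insert o Y) hsub
      (hY.trans (subset_insert _ _))
    -- source log-supermodularity from `c₃` to `c₂`, for `u` then `v`, target `Y₂`
    have hD2 : c₃ ∪ ↑((c₂ \ c₃).toFinite.toFinset) = c₂ := by
      ext a; simp only [mem_union, Set.Finite.coe_toFinset, mem_sdiff]
      constructor
      · rintro (ha | ⟨ha, -⟩); exacts [h₂ ha, ha]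
      · intro ha; by_cases h3 : a ∈ c₃; exacts [Or.inl h3, Or.inr ⟨ha, h3⟩]
    have hu := real_avoid_insert_ratio_mono w c₃ Y₂ u (c₂ \ c₃).toFinite.toFinset
    rw [hD2] at hu
    have hD3 : insert u c₃ ∪ ↑((c₂ \ c₃).toFinite.toFinset) = insert u c₂ := by
      rw [Set.insert_union, hD2]
    have huv := real_avoid_insert_ratio_mono w (insert u c₃) Y₂ v (c₂ \ c₃).toFinite.toFinset
    rw [hD3] at huv
    -- combine: `K(c₃,Y₂)·M3 ≥ M1·K(c₃uv,Y₂)`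
    set Q1 := 𝕂[w](c₃, Y₂) with hQ1
    set Q2 := 𝕂[w](insert u c₃, Y₂) with hQ2
    set Q3 := 𝕂[w](insert v (insert u c₃), Y₂) with hQ3
    have nQ1 : 0 ≤ Q1 := measureReal_nonneg
    have nQ2 : 0 ≤ Q2 := measureReal_nonneg
    have nQ3 : 0 ≤ Q3 := measureReal_nonneg
    have nM2 : 0 ≤ M2 := measureReal_nonneg
    have nM3 : 0 ≤ M3 := measureReal_nonneg
    have nP3 : 0 ≤ P3 := measureReal_nonneg
    -- hu : M1 * Q2 ≤ Q1 * M2 ;  huv : M2 * Q3 ≤ Q2 * M3 ;  hrr : Q1 * P3 ≤ P1 * Q3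
    have hchain : Q2 * (M1 * Q3) ≤ Q2 * (Q1 * M3) := by
      linarith [mul_le_mul_of_nonneg_right hu nQ3, mul_le_mul_of_nonneg_right huv nQ1]
    by_cases hq2 : Q2 = 0
    · -- then `Q3 = 0`, `P3 ≤ ...`: `P3 ≤ K(c₃uv, Y₂) = Q3 = 0`
      have hQ3z : Q3 = 0 := le_antisymm (hq2 ▸ real_avoid_anti w (subset_insert _ _) subset_rfl) nQ3
      have hP3z : P3 = 0 :=
        le_antisymm (hQ3z ▸ real_avoid_anti w subset_rfl (hY.trans (subset_insert _ _))) nP3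
      rw [hP3z, mul_zero, sub_zero]; exact mul_nonneg nP1 nM3
    · have hq2p : 0 < Q2 := lt_of_le_of_ne nQ2 (Ne.symm hq2)
      have hMQ : M1 * Q3 ≤ Q1 * M3 := le_of_mul_le_mul_left hchain hq2p
      by_cases hq1 : Q1 = 0
      · have hP1z : P1 = 0 := le_antisymm (hq1 ▸ real_avoid_anti w subset_rfl (hY.trans (subset_insert _ _))) nP1
        have hP3z : P3 = 0 := le_antisymm (hP1z ▸ real_avoid_anti w hsub subset_rfl) nP3
        rw [hP1z, hP3z]; simp
      · have hq1p : 0 < Q1 := lt_of_le_of_ne nQ1 (Ne.symm hq1)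
        -- `Q1·(P1 M3 − M1 P3) ≥ P1·(Q1 M3 − M1 Q3)·... ≥ 0`
        have : Q1 * 0 ≤ Q1 * (P1 * M3 - M1 * P3) := by
          linarith [mul_le_mul_of_nonneg_left hMQ nP1, mul_le_mul_of_nonneg_left hrr nM1]
        exact le_of_mul_le_mul_left this hq1p
  -- main step: `L1·det ≥ Γ₀·(L1 N2 − N1 L2) ≥ 0`
  by_cases hl1 : L1 = 0
  · -- then the whole first column of the target vanishes
    have hN1z : N1 = 0 := le_antisymm (hl1 ▸ real_avoid_anti w h₁ subset_rfl) nN1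
    have hN2z : N2 = 0 := le_antisymm (hN1z ▸ real_avoid_anti w (subset_insert _ _) subset_rfl) nN2
    rw [hN1z, hN2z]; simp
  · have hl1p : 0 < L1 := lt_of_le_of_ne nL1 (Ne.symm hl1)
    have key : L1 * 0 ≤ L1 * (N2 * (P1 * M3 - M1 * P3) - N1 * (P2 * M3 - M2 * P3)) := by
      linarith [mul_le_mul_of_nonneg_left hH nN1, mul_le_mul_of_nonneg_left hL hG]
    exact le_of_mul_le_mul_left key hl1p

/-! ### The proved endpoint: an empty middle target -/

/-- **THEOREM: the conjecture holds when the middle target is empty** (`Y' = ∅`, any `B`, `A = {x}`): the middle column is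
`(1,1,1)` and the minor equals `K(xu,Yv)(K(x,Yo) − K(xuv,Yo)) − K(x,Yv)(K(xu,Yo) − K(xuv,Yo))`, which is nonnegative by the
unconditional chain rule `Consts.unconditionalChainRule` (vdBHK for the source set `Y∪{v,o}`).
[cite: VandenbergHaggstromKahn2005, Thm. 1.3 (p. 6), Thm. 1.5 (p. 7)] -/
theorem dominatedChainRule_emptyTarget (w : Sym2 V → unitInterval) (x u v o : V) (B Y : Set V) :
    0 ≤ 𝔻ᶜ[w](({x} : Set V), Y ; B, (∅ : Set V) ; ({x} : Set V), Y | u, v, o) := by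
  classical
  have e2 : insert u ({x} : Set V) = {x, u} := pair_comm u x
  have e3 : insert v ({x, u} : Set V) = {x, u, v} := by
    ext b; simp only [mem_insert_iff, mem_singleton_iff]; tauto
  have hM1 : 𝕂[w](B, (∅ : Set V)) = 1 := real_avoid_emptyTarget w B
  have hM2 : 𝕂[w](insert u B, (∅ : Set V)) = 1 := real_avoid_emptyTarget w _
  have hM3 : 𝕂[w](insert v (insert u B), (∅ : Set V)) = 1 := real_avoid_emptyTarget w _
  have h31 : 𝕂[w](insert v (insert u ({x} : Set V)), insert v Y) = 0 :=
    real_avoid_eq_zero_of_mem w (mem_insert _ _) (mem_insert _ _)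
  rw [hM1, hM2, hM3, h31, det3_col1]
  have hT := unconditionalChainRule w x u v o Y
  rw [← e3, ← e2] at hT
  set N1 := 𝕂[w](({x} : Set V), insert v Y)
  set N2 := 𝕂[w](insert u ({x} : Set V), insert v Y)
  set P1 := 𝕂[w](({x} : Set V), insert o Y)
  set P2 := 𝕂[w](insert u ({x} : Set V), insert o Y)
  set P3 := 𝕂[w](insert v (insert u ({x} : Set V)), insert o Y)
  linarith [hT]

/-! ### What the conjecture signs in the edge-Bernstein expansion -/

omit [Fintype V] in
/-- **Row-mixed and column-mixed Bernstein coefficients agree.**  For two `3 × 3` matrices `M, M'` (rows `A,B,C` and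
`A',B',C'`): `det[A';B;C] + det[A;B';C] + det[A;B;C']` equals the sum of the three determinants obtained from `M` by replacing
ONE column by the corresponding column of `M'`, and likewise for two rows / two columns (both are the mixed coefficients of
`t ↦ det((1−t)M + tM')`). [folklore] -/
theorem edgeBernstein_rowMix_eq_colMix (A1 A2 A3 B1 B2 B3 C1 C2 C3 A1' A2' A3' B1' B2' B3' C1' C2' C3' : ℝ) :
    (Matrix.det !![A1', A2', A3'; B1, B2, B3; C1, C2, C3] + Matrix.det !![A1, A2, A3; B1', B2', B3'; C1, C2, C3] +
        Matrix.det !![A1, A2, A3; B1, B2, B3; C1', C2', C3'] =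
      Matrix.det !![A1', A2, A3; B1', B2, B3; C1', C2, C3] + Matrix.det !![A1, A2', A3; B1, B2', B3; C1, C2', C3] +
        Matrix.det !![A1, A2, A3'; B1, B2, B3'; C1, C2, C3']) ∧
    (Matrix.det !![A1', A2', A3'; B1', B2', B3'; C1, C2, C3] + Matrix.det !![A1', A2', A3'; B1, B2, B3; C1', C2', C3'] +
        Matrix.det !![A1, A2, A3; B1', B2', B3'; C1', C2', C3'] =
      Matrix.det !![A1', A2', A3; B1', B2', B3; C1', C2', C3] + Matrix.det !![A1', A2, A3'; B1', B2, B3'; C1', C2, C3'] +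
        Matrix.det !![A1, A2', A3'; B1, B2', B3'; C1, C2', C3']) := by
  simp only [det3_eq]
  constructor <;> ring

/-- **THEOREM: the conjecture signs the column-mixed determinants in which `z` does not enter the `Yo`-column's source.**
For a source set `X`, a vertex `z` and all `u, v, o, Y`: `D(Xz,X,X) ≥ 0`, `D(X,Xz,X) ≥ 0`, `D(Xz,Xz,X) ≥ 0`, where
`D(c₁,c₂,c₃)` is the minor with source bases `c₁, c₂, c₃` (targets `Yv, Y, Yo`).  With `Consts.edgeBernstein_rowMix_eq_colMix`
the two conjuncts of `Consts.ChainRuleEdgeBernstein` are `D(Xz,X,X) + D(X,Xz,X) + D(X,X,Xz) ≥ 0` and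
`D(Xz,Xz,X) + D(Xz,X,Xz) + D(X,Xz,Xz) ≥ 0`; the remaining terms `D(X,X,Xz)`, `D(Xz,X,Xz)`, `D(X,Xz,Xz)` are two-signed.
[cite: VandenbergHaggstromKahn2005, Thm. 1.1 (pp. 3–5)] -/
theorem colMixed_nonneg_of_dominated (h : DominatedChainRule) (n : ℕ) (w : Sym2 (Fin n) → unitInterval)
    (X : Set (Fin n)) (z u v o : Fin n) (Y : Set (Fin n)) :
    0 ≤ 𝔻ᶜ[w](insert z X, Y ; X, Y ; X, Y | u, v, o) ∧ 0 ≤ 𝔻ᶜ[w](X, Y ; insert z X, Y ; X, Y | u, v, o) ∧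
      0 ≤ 𝔻ᶜ[w](insert z X, Y ; insert z X, Y ; X, Y | u, v, o) :=
  ⟨threeColumn_nonneg_of_dominated h n w _ _ _ u v o Y Y (subset_insert _ _) subset_rfl subset_rfl,
    threeColumn_nonneg_of_dominated h n w _ _ _ u v o Y Y subset_rfl (subset_insert _ _) subset_rfl,
    threeColumn_nonneg_of_dominated h n w _ _ _ u v o Y Y (subset_insert _ _) (subset_insert _ _) subset_rfl⟩

end Consts

end Summit.CriticalPhenomena.PercolationContinuityZ3.Theorems

end
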